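import Summits.ResolutionOfSingularities.ResolutionOfSingularities.Theorems.FrobeniusLadderFRationalResolutionEquivariantLadder
import Summits.ResolutionOfSingularities.ResolutionOfSingularities.Theorems.FrobeniusLadderFRationalResolutionInvariantSupport
import Summits.ResolutionOfSingularities.ResolutionOfSingularities.Theorems.FrobeniusLadderFRationalResolutionFanSupportSparing
import HarnessLib

/-!
# Crux `FrobeniusLadder.FRationalResolution` (stmt-ResolutionOfSingularities-15317), line `redirect`,
# stub `stub_diagonalizableQuotientResolution` — the equivariant ladder WITH INVARIANT PROJECTIVE SUPPORT DATA (lane W‴, L2 complete)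

Packaging of `…EquivariantLadder` (✓ p831219: `G`-stable boundary-sparing regular refinement of the isolated cone by star
subdivisions), `…FanSupportSparing` (✓, support data tracked along a star sequence, vanishing on spared cones) and
`…InvariantSupport` (✓ p831270: symmetrisation). The loop is re-run with a predicate on the STAR POINTS (each avoids every
proper face of `σ`), which is what the value tracking needs; then the support data are tightened, made integral and
averaged over `G`.

* `exists_regular_starIter_of_invariant_pts` — the tree's synchronised loop `Fan.exists_regular_starIter_of_invariant` with an
  extra predicate on the star points carried to the output list;
* `exists_equivariant_regular_starIter_avoiding` — the ladder theorem with the extra conclusion that no star point lies in a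
  proper face of `σ`;
* **`exists_equivariant_projective_ladder`** — the ladder fan carries `G`-INVARIANT integral tight strict support data,
  non-negative on `σ`, vanishing on every proper face of `σ`, positive somewhere (KKMS I §2 Thm. 11 for one isolated cone,
  equivariant and boundary-sparing: the blow-up centre it defines is `𝔪`-primary and symmetric).

Honest label: fan combinatorics for the DESIGN W‴ (statement L2 of memo MEMO-15317-leafhand4-g5 in full; consumers L1/L3 are
NOT in the tree). No stub closed by name. No definitions, no named facts, no sorry.
[cite: KempfEtAl1973, Ch. I §2 Thm. 10, Thm. 11, Ch. II §2] [cite: Fulton1993Toric, §2.6 p. 48] [cite: Ewald1996, VI Thm. 8.5]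
-/

-- single-problem summit: the doubled namespace component is forced
set_option linter.dupNamespace false

namespace Summit.ResolutionOfSingularities.ResolutionOfSingularities.Theorems.FRationalResolution.EquivariantLadderSupport

open Literature.Geometry.PolyhedralFans PointedCone Finset Matrix
open Summit.ResolutionOfSingularities.ResolutionOfSingularities.Theorems.FRationalResolution.OrbitSeparation
open Summit.ResolutionOfSingularities.ResolutionOfSingularities.Theorems.FRationalResolution.EquivariantStep
open Summit.ResolutionOfSingularities.ResolutionOfSingularities.Theorems.FRationalResolution.EquivariantLadder
open Summit.ResolutionOfSingularities.ResolutionOfSingularities.Theorems.FRationalResolution.InvariantSupport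

variable {κ : Type*} [Fintype κ] [DecidableEq κ]

/-- **The synchronised regularisation loop with a predicate on the star points** (the tree's
`Fan.exists_regular_starIter_of_invariant`, [Ewald1996] VI Thm. 8.5 / [KempfEtAl1973] II §2, induction on `(maxPMult, numMax)`):
if every step also certifies a property `Q` of each of its points, the output list consists of points satisfying `Q`.
[cite: Ewald1996, VI Thm. 8.5] [cite: KempfEtAl1973, Ch. II §2] -/
theorem exists_regular_starIter_of_invariant_pts {I : Fan ℚ (κ → ℚ) → Prop} {Q : (κ → ℚ) → Prop}
    (step : ∀ Γ : Fan ℚ (κ → ℚ), I Γ → Γ.IsPrimSimplicial → ¬ Γ.IsRegular →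
      ∃ l : List (κ → ℚ), l ≠ [] ∧ l.Nodup ∧
        (∀ z ∈ l, IsPrimitive z ∧ ∃ σ ∈ Γ.cones, ∃ S : Finset (κ → ℚ), IsPrimGens σ S ∧
          conePMult σ = Γ.maxPMult ∧ ∃ a ∈ parCoeffs S, z = ∑ s ∈ S, a s • s) ∧
        (∀ σ ∈ Γ.cones, ∀ z ∈ l, ∀ z' ∈ l, z ∈ σ → z' ∈ σ → z = z') ∧ I (Γ.starIter l) ∧ ∀ z ∈ l, Q z)
    {Δ : Fan ℚ (κ → ℚ)} (hI : I Δ) (hΔ : Δ.IsPrimSimplicial) :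
    ∃ L : List (κ → ℚ), (∀ w ∈ L, w ∈ latticeN κ ∧ w ≠ 0 ∧ Q w) ∧ (Δ.starIter L).Refines Δ ∧
      (Δ.starIter L).IsRegular ∧ (Δ.starIter L).IsPrimSimplicial ∧ I (Δ.starIter L) := by
  suffices h : ∀ M N : ℕ, ∀ Δ : Fan ℚ (κ → ℚ), I Δ → Δ.IsPrimSimplicial → Δ.maxPMult = M →
      Δ.numMax = N → ∃ L : List (κ → ℚ), (∀ w ∈ L, w ∈ latticeN κ ∧ w ≠ 0 ∧ Q w) ∧
        (Δ.starIter L).Refines Δ ∧ (Δ.starIter L).IsRegular ∧ (Δ.starIter L).IsPrimSimplicial ∧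
        I (Δ.starIter L) from h _ _ Δ hI hΔ rfl rfl
  intro M
  induction M using Nat.strong_induction_on with
  | _ M ihM =>
    intro N
    induction N using Nat.strong_induction_on with
    | _ N ihN =>
      intro Δ hI hΔ hM hN
      by_cases hreg : Δ.IsRegular
      · exact ⟨[], fun _ h => absurd h List.not_mem_nil, Fan.Refines.refl Δ, hreg, hΔ, hI⟩
      · obtain ⟨l, hlne, hlnd, hZ, hsep, hI', hQ⟩ := step Δ hI hΔ hreg
        obtain ⟨hΔ', hlex⟩ := Fan.multiStep_measure_lt hΔ hlne hZ hlnd hsep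
        have hl0 : ∀ w ∈ l, w ∈ latticeN κ ∧ w ≠ 0 ∧ Q w :=
          fun w hw => ⟨(hZ w hw).1.1, (hZ w hw).1.2.1, hQ w hw⟩
        have hlsupp : ∀ w ∈ l, w ∈ Δ.support := by
          intro w hw
          obtain ⟨-, σ, hσ, S, hS, -, a, ha, hwa⟩ := hZ w hw
          refine Fan.mem_support.mpr ⟨σ, hσ, ?_⟩
          rw [hwa, hS.2.2]; exact sum_smul_mem_hull fun s hs => (ha.1 s hs).1
        have hstep : (Δ.starIter l).Refines Δ :=
          Fan.starIter_refines_of_mem_support l hlsupp fun w hw => (hl0 w hw).2.1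
        obtain ⟨L, hL, href, hreg', hps', hI''⟩ : ∃ L : List (κ → ℚ), (∀ w ∈ L, w ∈ latticeN κ ∧ w ≠ 0 ∧ Q w) ∧
            ((Δ.starIter l).starIter L).Refines (Δ.starIter l) ∧
            ((Δ.starIter l).starIter L).IsRegular ∧ ((Δ.starIter l).starIter L).IsPrimSimplicial ∧
            I ((Δ.starIter l).starIter L) := by
          rcases hlex with h1 | ⟨h1, h2⟩
          · exact ihM _ (hM ▸ h1) _ _ hI' hΔ' rfl rfl
          · exact ihN _ (hN ▸ h2) _ hI' hΔ' (h1.trans hM) rfl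
        refine ⟨l ++ L, fun v hv => ?_, ?_, ?_, ?_, ?_⟩
        · rcases List.mem_append.mp hv with hv | hv
          · exact hl0 v hv
          · exact hL v hv
        · rw [Fan.starIter_append]; exact href.trans hstep
        · rw [Fan.starIter_append]; exact hreg'
        · rw [Fan.starIter_append]; exact hps'
        · rw [Fan.starIter_append]; exact hI''

/-- **The equivariant boundary-sparing ladder, with the star points avoiding the boundary.** Same hypotheses and conclusions
as `EquivariantLadder.exists_equivariant_regular_starIter`, plus: no star point lies in a proper face of `σ = hull S₀` (round 0:
the corner is interior; later: orbit points are parallelotope points of cones of the current fan and avoid its regular cones,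
among which the proper faces of `σ`). [cite: KempfEtAl1973, Ch. I §2 Thm. 11, Ch. II §2] [cite: Fulton1993Toric, §2.6 p. 48] -/
theorem exists_equivariant_regular_starIter_avoiding {S₀ : Finset (κ → ℚ)} (hprim : ∀ s ∈ S₀, IsPrimitive s)
    (hli : LinearIndepOn ℚ id (S₀ : Set (κ → ℚ))) (h2 : 2 ≤ S₀.card)
    (hiso : ∀ J : Finset (κ → ℚ), J ⊂ S₀ → IsRegularGens J)
    (hfg : (PointedCone.hull ℚ (S₀ : Set (κ → ℚ))).FG) (hsal : IsSalient (PointedCone.hull ℚ (S₀ : Set (κ → ℚ))))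
    {G : Set ((κ → ℚ) ≃ₗ[ℚ] (κ → ℚ))} (hGfin : G.Finite) (hG1 : LinearEquiv.refl ℚ (κ → ℚ) ∈ G)
    (hGN : ∀ g ∈ G, ∀ x ∈ latticeN κ, g x ∈ latticeN κ)
    (hGsymm : ∀ g ∈ G, g.symm ∈ G) (hGtrans : ∀ g ∈ G, ∀ h ∈ G, g.trans h ∈ G)
    (hGS₀ : ∀ g ∈ G, ∀ s ∈ S₀, g s ∈ S₀)
    (P : (κ → ℚ) → Prop)
    (hP₁ : ∀ q : ℚ, 0 < q → IsPrimitive (q • ∑ s ∈ S₀, s) → P (q • ∑ s ∈ S₀, s))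
    (hP₂ : ∀ (T : Finset (κ → ℚ)) (a : (κ → ℚ) → ℚ), (∀ t ∈ T, t ∈ S₀ ∨ P t) → a ∈ parCoeffs T →
      P (∑ t ∈ T, a t • t)) :
    ∃ l : List (κ → ℚ), l ≠ [] ∧ (∀ w ∈ l, w ∈ latticeN κ ∧ w ≠ 0) ∧
      (∀ w ∈ l.head?, w ∈ PointedCone.hull ℚ (S₀ : Set (κ → ℚ))) ∧
      ((Fan.ofCone _ hfg hsal).starIter l).Refines (Fan.ofCone _ hfg hsal) ∧
      ((Fan.ofCone _ hfg hsal).starIter l).IsRegular ∧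
      ((Fan.ofCone _ hfg hsal).starIter l).IsPrimSimplicial ∧
      (∀ g ∈ G, ∀ ρ ∈ ((Fan.ofCone _ hfg hsal).starIter l).cones,
        ρ.map (g : (κ → ℚ) →ₗ[ℚ] (κ → ℚ)) ∈ ((Fan.ofCone _ hfg hsal).starIter l).cones) ∧
      (∀ τ : PointedCone ℚ (κ → ℚ), τ.IsFaceOf (PointedCone.hull ℚ (S₀ : Set (κ → ℚ))) →
        τ ≠ PointedCone.hull ℚ (S₀ : Set (κ → ℚ)) →
          τ ∈ ((Fan.ofCone _ hfg hsal).starIter l).cones ∧ ∀ w ∈ l, w ∉ τ) ∧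
      (∀ g ∈ G, ∀ κ' ∈ ((Fan.ofCone _ hfg hsal).starIter l).cones, ∀ K : Finset (κ → ℚ), IsPrimGens κ' K →
        ∀ t ∈ K, t ∉ S₀ → g t ∈ K → g t = t) ∧
      (∀ ρ ∈ ((Fan.ofCone _ hfg hsal).starIter l).cones, ∀ K : Finset (κ → ℚ), IsPrimGens ρ K →
        ∀ r ∈ K, r ∈ S₀ ∨ P r) := by
  classical
  set Δ₀ := Fan.ofCone (PointedCone.hull ℚ (S₀ : Set (κ → ℚ))) hfg hsal with hΔ₀def
  have hΔ₀ : ∀ τ, τ ∈ Δ₀.cones ↔ τ.IsFaceOf (PointedCone.hull ℚ (S₀ : Set (κ → ℚ))) := fun τ => Fan.mem_ofCone_iff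
  have hps₀ : Δ₀.IsPrimSimplicial := Fan.isPrimSimplicial_ofCone_hull (fun s hs => (hprim s hs).1) hli hfg hsal
  have hne : S₀.Nonempty := Finset.card_pos.mp (by omega)
  have hc₀N : ∑ s ∈ S₀, s ∈ latticeN κ := Submodule.sum_mem _ fun s hs => (hprim s hs).1
  obtain ⟨q, hq, -, hc⟩ := exists_isPrimitive_smul hc₀N (sum_ne_zero hli hne)
  set c := q • ∑ s ∈ S₀, s with hcq
  have hPc : P c := hP₁ q hq hc
  have hcσ : c ∈ PointedCone.hull ℚ (S₀ : Set (κ → ℚ)) :=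
    smul_mem_of_nonneg (Submodule.sum_mem _ fun s hs => PointedCone.subset_hull (Finset.mem_coe.mpr hs)) hq.le
  obtain ⟨hps₁, hG₁, hfix₁, hσ₁, hle₁, hfaces₁, hP₁'⟩ :=
    round_zero hprim hli h2 hΔ₀ hps₀ hGsymm hGS₀ hc hq hcq P hPc
  set Δ₁ := Δ₀.starIter [c] with hΔ₁def
  let I : Fan ℚ (κ → ℚ) → Prop := fun Δ' =>
    (∀ g ∈ G, ∀ ρ ∈ Δ'.cones, ρ.map (g : (κ → ℚ) →ₗ[ℚ] (κ → ℚ)) ∈ Δ'.cones) ∧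
    (∀ g ∈ G, ∀ κ' ∈ Δ'.cones, ∀ K : Finset (κ → ℚ), IsPrimGens κ' K → ∀ t ∈ K, t ∉ S₀ → g t ∈ K → g t = t) ∧
    PointedCone.hull ℚ (S₀ : Set (κ → ℚ)) ∉ Δ'.cones ∧
    (∀ ρ ∈ Δ'.cones, ρ ≤ PointedCone.hull ℚ (S₀ : Set (κ → ℚ))) ∧
    (∀ τ ∈ Δ₀.cones, τ ≠ PointedCone.hull ℚ (S₀ : Set (κ → ℚ)) → τ ∈ Δ'.cones) ∧
    (∀ ρ ∈ Δ'.cones, ∀ K : Finset (κ → ℚ), IsPrimGens ρ K → ∀ r ∈ K, r ∈ S₀ ∨ P r)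
  let Q : (κ → ℚ) → Prop := fun w =>
    ∀ τ ∈ Δ₀.cones, τ ≠ PointedCone.hull ℚ (S₀ : Set (κ → ℚ)) → w ∉ τ
  have hI₁ : I Δ₁ := ⟨hG₁, hfix₁, hσ₁, hle₁, hfaces₁, hP₁'⟩
  have step : ∀ Γ : Fan ℚ (κ → ℚ), I Γ → Γ.IsPrimSimplicial → ¬ Γ.IsRegular →
      ∃ l : List (κ → ℚ), l ≠ [] ∧ l.Nodup ∧
        (∀ z ∈ l, IsPrimitive z ∧ ∃ σ ∈ Γ.cones, ∃ S : Finset (κ → ℚ), IsPrimGens σ S ∧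
          conePMult σ = Γ.maxPMult ∧ ∃ a ∈ parCoeffs S, z = ∑ s ∈ S, a s • s) ∧
        (∀ σ ∈ Γ.cones, ∀ z ∈ l, ∀ z' ∈ l, z ∈ σ → z' ∈ σ → z = z') ∧ I (Γ.starIter l) ∧ ∀ z ∈ l, Q z := by
    rintro Γ ⟨hGΓ, hfixΓ, hσΓ, hleΓ, hfacesΓ, hPΓ⟩ hpsΓ hnr
    obtain ⟨σ₁, hσ₁Γ, S, hS, hcount, a, ha, hwprim, -, j, hj, haj⟩ := Fan.exists_parPoint_of_not_isRegular hpsΓ hnr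
    set w := ∑ s ∈ S, a s • s with hwdef
    have hw0 : w ≠ 0 := hwprim.2.1
    set Z : Finset (κ → ℚ) := hGfin.toFinset.image (fun g : (κ → ℚ) ≃ₗ[ℚ] (κ → ℚ) => g w) with hZdef
    set l := Z.toList with hldef
    have hlZ : ∀ z, z ∈ l ↔ z ∈ Z := fun z => Finset.mem_toList
    have hl : ∀ z ∈ l, ∃ g ∈ G, z = g w := by
      intro z hz
      obtain ⟨g, hg, rfl⟩ := Finset.mem_image.mp ((hlZ z).1 hz)
      exact ⟨g, hGfin.mem_toFinset.mp hg, rfl⟩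
    have hmemZ : ∀ g ∈ G, g w ∈ l := fun g hg =>
      (hlZ _).2 (Finset.mem_image.mpr ⟨g, hGfin.mem_toFinset.mpr hg, rfl⟩)
    have hlG : ∀ g ∈ G, ∀ z ∈ l, g z ∈ l := by
      intro g hg z hz
      obtain ⟨h, hh, rfl⟩ := hl z hz
      have := hmemZ _ (hGtrans h hh g hg)
      simpa using this
    have hnd : l.Nodup := Finset.nodup_toList Z
    have hlne : l ≠ [] := by
      intro h
      have := hmemZ _ hG1
      rw [h] at this
      exact List.not_mem_nil this
    have hsep := orbitList_separated hpsΓ hleΓ hσΓ hiso hGN hGsymm hGtrans hGS₀ hGΓ hfixΓ hσ₁Γ hS ha hl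
    have hprimZ : ∀ z ∈ l, IsPrimitive z := by
      intro z hz
      obtain ⟨g, hg, rfl⟩ := hl z hz
      exact (orbit_point g (hGN g hg) (hGN _ (hGsymm g hg)) hS ha).2.2.2.2 hwprim
    have havoid : ∀ τ ∈ Δ₀.cones, τ ≠ PointedCone.hull ℚ (S₀ : Set (κ → ℚ)) →
        τ ∈ (Γ.starIter l).cones ∧ ∀ z ∈ l, z ∉ τ := by
      intro τ hτ hne'
      obtain ⟨J, hJ, hJreg⟩ := exists_isPrimGens_isRegularGens_of_isFaceOf hprim hli hiso ((hΔ₀ τ).1 hτ) hne'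
      exact mem_starIter_orbit_of_isRegularGens hGN hGsymm hGΓ hσ₁Γ hS ha hw0 hnd hl hsep (hfacesΓ τ hτ hne')
        hJ hJreg
    refine ⟨l, hlne, hnd, ?_, hsep, ⟨?_, ?_, ?_, ?_, ?_, ?_⟩, ?_⟩
    · intro z hz
      obtain ⟨g, hg, rfl⟩ := hl z hz
      obtain ⟨hT₁, ha₁, hsum₁, hcount₁, hprim₁⟩ := orbit_point g (hGN g hg) (hGN _ (hGsymm g hg)) hS ha
      exact ⟨hprim₁ hwprim, _, hGΓ g hg σ₁ hσ₁Γ, S.image g, hT₁, hcount₁.trans hcount, _, ha₁, hsum₁.symm⟩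
    · intro g hg ρ hρ
      exact map_mem_starIter_of_closed hGsymm hGΓ hnd hlG hsep hg hρ
    · intro g hg κ' hκ' K hK t ht htS hgt
      exact fix_starIter_of_closed hpsΓ hGsymm hfixΓ hnd hlG hprimZ hsep hg hκ' hK ht htS hgt
    · exact hull_notMem_starIter hleΓ hσΓ l
    · intro ρ hρ
      exact le_hull_of_mem_starIter hleΓ l hρ
    · intro τ hτ hne'
      exact (havoid τ hτ hne').1
    · intro ρ hρ K hK r hr
      rw [Fan.mem_starIter_cones_iff_of_separated l hnd hsep] at hρ
      rcases hρ with ⟨hρΓ, -⟩ | ⟨z, hz, τ, hτ, hzτ, ⟨σ', hσ', hτσ', hzσ'⟩, rfl⟩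
      · exact hPΓ ρ hρΓ K hK r hr
      · obtain ⟨Tτ, hTτ⟩ := hpsΓ.exists_isPrimGens hτ
        have hnew := isPrimGens_sup_ray hτ hσ' hτσ' hTτ (hprimZ z hz) hzσ' hzτ
        rw [hK.unique hnew] at hr
        rcases Finset.mem_insert.mp hr with rfl | hrT
        · obtain ⟨g, hg, rfl⟩ := hl _ hz
          obtain ⟨hT₁, ha₁, hsum₁, -, -⟩ := orbit_point g (hGN g hg) (hGN _ (hGsymm g hg)) hS ha
          rw [← hsum₁]
          exact Or.inr (hP₂ _ _ (fun u hu => hPΓ _ (hGΓ g hg σ₁ hσ₁Γ) _ hT₁ u hu) ha₁)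
        · exact hPΓ τ hτ Tτ hTτ r hrT
    · intro z hz τ hτ hne'
      exact (havoid τ hτ hne').2 z hz
  obtain ⟨L, hL, href, hreg, hps', hI'⟩ := exists_regular_starIter_of_invariant_pts step hI₁ hps₁
  obtain ⟨hG', hfix', -, -, hfaces', hP'⟩ := hI'
  have hcsupp : c ∈ Δ₀.support := by rw [hΔ₀def, Fan.support_ofCone]; exact hcσ
  have href₁ : Δ₁.Refines Δ₀ := (Fan.starSubdivision_refines hcsupp hc.2.1).1
  refine ⟨c :: L, List.cons_ne_nil c L, ?_, ?_, ?_, ?_, ?_, ?_, ?_, ?_, ?_⟩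
  · intro w hw
    rcases List.mem_cons.mp hw with rfl | hw
    · exact ⟨hc.1, hc.2.1⟩
    · exact ⟨(hL w hw).1, (hL w hw).2.1⟩
  · intro w hw
    simp only [List.head?_cons, Option.mem_def, Option.some.injEq] at hw
    rw [← hw]; exact hcσ
  · rw [Fan.starIter_cons]; exact href.trans href₁
  · rw [Fan.starIter_cons]; exact hreg
  · rw [Fan.starIter_cons]; exact hps'
  · rw [Fan.starIter_cons]; exact hG'
  · intro τ hτ hne'
    refine ⟨by rw [Fan.starIter_cons]; exact hfaces' τ ((hΔ₀ τ).2 hτ) hne', fun w hw => ?_⟩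
    rcases List.mem_cons.mp hw with rfl | hw
    · exact corner_notMem_of_isFaceOf_of_ne hli hτ hne' hq
    · exact (hL w hw).2.2 τ ((hΔ₀ τ).2 hτ) hne'
  · rw [Fan.starIter_cons]; exact hfix'
  · rw [Fan.starIter_cons]; exact hP'

/-- **THE EQUIVARIANT PROJECTIVE LADDER (lane W‴, statement L2 complete).** For the isolated simplicial cone `σ = hull S₀`
(`|S₀| ≥ 2` linearly independent primitive lattice vectors, proper subfamilies regular), a finite group `G` of lattice
automorphisms permuting `S₀`, and a property `P` of vectors holding for the primitive corner and closed under parallelotope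
lattice points: there is a list `l` of non-zero lattice vectors such that `Δ' = (face fan of σ).starIter l` refines the face
fan, is REGULAR, primitively simplicial, `G`-STABLE, keeps every proper face of `σ` (no star point lies in one), every primitive
generator of every cone is in `S₀` or satisfies `P`, and `Δ'` carries tight strict support data `m` ([KempfEtAl1973] I §2
Thm. 10) which are INTEGRAL, NON-NEGATIVE on `σ`, VANISH on every proper face of `σ`, are `G`-INVARIANT
(`m (h ρ) · (h x) = m ρ · x`) and POSITIVE somewhere — i.e. the refinement is the normalised blow-up of a `G`-symmetric
`𝔪`-primary monomial ideal of the toric chart (KKMS I §2 Thm. 11 for one cone, equivariant and boundary-sparing).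
[cite: KempfEtAl1973, Ch. I §2 Thm. 10, Thm. 11, Ch. II §2] [cite: Fulton1993Toric, §2.6 p. 48] -/
theorem exists_equivariant_projective_ladder {S₀ : Finset (κ → ℚ)} (hprim : ∀ s ∈ S₀, IsPrimitive s)
    (hli : LinearIndepOn ℚ id (S₀ : Set (κ → ℚ))) (h2 : 2 ≤ S₀.card)
    (hiso : ∀ J : Finset (κ → ℚ), J ⊂ S₀ → IsRegularGens J)
    (hfg : (PointedCone.hull ℚ (S₀ : Set (κ → ℚ))).FG) (hsal : IsSalient (PointedCone.hull ℚ (S₀ : Set (κ → ℚ))))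
    {G : Set ((κ → ℚ) ≃ₗ[ℚ] (κ → ℚ))} (hGfin : G.Finite) (hG1 : LinearEquiv.refl ℚ (κ → ℚ) ∈ G)
    (hGN : ∀ g ∈ G, ∀ x ∈ latticeN κ, g x ∈ latticeN κ)
    (hGsymm : ∀ g ∈ G, g.symm ∈ G) (hGtrans : ∀ g ∈ G, ∀ h ∈ G, g.trans h ∈ G)
    (hGS₀ : ∀ g ∈ G, ∀ s ∈ S₀, g s ∈ S₀)
    (P : (κ → ℚ) → Prop)
    (hP₁ : ∀ q : ℚ, 0 < q → IsPrimitive (q • ∑ s ∈ S₀, s) → P (q • ∑ s ∈ S₀, s))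
    (hP₂ : ∀ (T : Finset (κ → ℚ)) (a : (κ → ℚ) → ℚ), (∀ t ∈ T, t ∈ S₀ ∨ P t) → a ∈ parCoeffs T →
      P (∑ t ∈ T, a t • t)) :
    ∃ l : List (κ → ℚ), (∀ w ∈ l, w ∈ latticeN κ ∧ w ≠ 0) ∧
      ((Fan.ofCone _ hfg hsal).starIter l).Refines (Fan.ofCone _ hfg hsal) ∧
      ((Fan.ofCone _ hfg hsal).starIter l).IsRegular ∧
      ((Fan.ofCone _ hfg hsal).starIter l).IsPrimSimplicial ∧
      (∀ g ∈ G, ∀ ρ ∈ ((Fan.ofCone _ hfg hsal).starIter l).cones,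
        ρ.map (g : (κ → ℚ) →ₗ[ℚ] (κ → ℚ)) ∈ ((Fan.ofCone _ hfg hsal).starIter l).cones) ∧
      (∀ τ : PointedCone ℚ (κ → ℚ), τ.IsFaceOf (PointedCone.hull ℚ (S₀ : Set (κ → ℚ))) →
        τ ≠ PointedCone.hull ℚ (S₀ : Set (κ → ℚ)) →
          τ ∈ ((Fan.ofCone _ hfg hsal).starIter l).cones ∧ ∀ w ∈ l, w ∉ τ) ∧
      (∀ ρ ∈ ((Fan.ofCone _ hfg hsal).starIter l).cones, ∀ K : Finset (κ → ℚ), IsPrimGens ρ K →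
        ∀ r ∈ K, r ∈ S₀ ∨ P r) ∧
      ∃ m : PointedCone ℚ (κ → ℚ) → (κ → ℚ),
        ((Fan.ofCone _ hfg hsal).starIter l).IsStrictSupport m ∧
        (∀ ρ ∈ ((Fan.ofCone _ hfg hsal).starIter l).cones, m ρ ∈ latticeN κ) ∧
        (∀ ρ ∈ ((Fan.ofCone _ hfg hsal).starIter l).cones, ∀ x ∈ PointedCone.hull ℚ (S₀ : Set (κ → ℚ)),
          0 ≤ m ρ ⬝ᵥ x) ∧
        (∀ τ : PointedCone ℚ (κ → ℚ), τ.IsFaceOf (PointedCone.hull ℚ (S₀ : Set (κ → ℚ))) →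
          τ ≠ PointedCone.hull ℚ (S₀ : Set (κ → ℚ)) →
          ∀ ρ ∈ ((Fan.ofCone _ hfg hsal).starIter l).cones, ∀ x ∈ ρ, x ∈ τ → m ρ ⬝ᵥ x = 0) ∧
        (∀ h ∈ G, ∀ (ρ : PointedCone ℚ (κ → ℚ)) (x : κ → ℚ),
          m (ρ.map (h : (κ → ℚ) →ₗ[ℚ] (κ → ℚ))) ⬝ᵥ h x = m ρ ⬝ᵥ x) ∧
        (∃ ρ ∈ ((Fan.ofCone _ hfg hsal).starIter l).cones, ∃ x ∈ ρ, 0 < m ρ ⬝ᵥ x) := by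
  classical
  obtain ⟨l, hlne, hl, hhead, href, hreg, hps, hG, hfaces, -, hP⟩ :=
    exists_equivariant_regular_starIter_avoiding hprim hli h2 hiso hfg hsal hGfin hG1 hGN hGsymm hGtrans hGS₀ P hP₁ hP₂
  set Δ₀ := Fan.ofCone (PointedCone.hull ℚ (S₀ : Set (κ → ℚ))) hfg hsal with hΔ₀def
  set Δ' := Δ₀.starIter l with hΔ'def
  refine ⟨l, hl, href, hreg, hps, hG, hfaces, hP, ?_⟩
  -- support data tracked along the star sequence, from `f = 0`
  obtain ⟨D, hnn, hvan, -, hhead'⟩ := Fan.SupportData.exists_starIter_vanishing l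
    (Fan.SupportData.ofCone (PointedCone.hull ℚ (S₀ : Set (κ → ℚ))) hfg hsal) (fun w hw => (hl w hw).2)
    (fun _ => le_rfl)
  -- tighten and clear denominators
  have h₁ : Δ'.IsStrictSupport D.tightPiece := D.isStrictSupport_tightPiece
  obtain ⟨N, hN, hint⟩ := Fan.exists_nat_smul_integral Δ' D.tightPiece
  have hN' : (0 : ℚ) < N := by exact_mod_cast hN
  set m₂ : PointedCone ℚ (κ → ℚ) → (κ → ℚ) := fun ρ => (N : ℚ) • D.tightPiece ρ with hm₂
  have h₂ : Δ'.IsStrictSupport m₂ := by rw [hm₂]; exact h₁.smul hN'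
  have hsupp : Δ'.support = (PointedCone.hull ℚ (S₀ : Set (κ → ℚ)) : Set (κ → ℚ)) := by
    rw [hΔ'def, href.support_eq, Fan.support_ofCone]
  have hMpos : 0 < D.tightM := D.tightM_pos
  have hval : ∀ ρ ∈ Δ'.cones, ∀ x ∈ ρ, m₂ ρ ⬝ᵥ x = N * (D.tightM * D.f x) := by
    intro ρ hρ x hx
    simp only [hm₂, smul_dotProduct, smul_eq_mul]
    rw [← ((D.tight_local hρ (D.le_domain hρ hx)).2.mpr hx)]
  -- properties of `m₂`
  have hint₂ : ∀ ρ ∈ Δ'.cones, m₂ ρ ∈ latticeN κ := fun ρ hρ => by rw [hm₂]; exact hint ρ hρ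
  have hnn_own : ∀ ρ ∈ Δ'.cones, ∀ x ∈ ρ, 0 ≤ m₂ ρ ⬝ᵥ x := by
    intro ρ hρ x hx
    rw [hval ρ hρ x hx]
    exact mul_nonneg hN'.le (mul_nonneg hMpos.le (hnn x))
  have hnn₂ : ∀ ρ ∈ Δ'.cones, ∀ x ∈ PointedCone.hull ℚ (S₀ : Set (κ → ℚ)), 0 ≤ m₂ ρ ⬝ᵥ x := by
    intro ρ hρ x hx
    have hxs : x ∈ Δ'.support := by rw [hsupp]; exact hx
    obtain ⟨ρ', hρ', hxρ'⟩ := Fan.mem_support.mp hxs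
    exact (hnn_own ρ' hρ' x hxρ').trans (h₂ hρ hρ' hxρ').1
  have hvan₂ : ∀ τ : PointedCone ℚ (κ → ℚ), τ.IsFaceOf (PointedCone.hull ℚ (S₀ : Set (κ → ℚ))) →
      τ ≠ PointedCone.hull ℚ (S₀ : Set (κ → ℚ)) → ∀ ρ ∈ Δ'.cones, ∀ x ∈ ρ, x ∈ τ → m₂ ρ ⬝ᵥ x = 0 := by
    intro τ hτ hne ρ hρ x hxρ hxτ
    have hτ₀ : τ ∈ Δ₀.cones := Fan.mem_ofCone_iff.mpr hτ
    obtain ⟨hτ', hzero⟩ := hvan τ hτ₀ (hfaces τ hτ hne).2 (fun _ _ => rfl)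
    rw [h₂.eq_of_mem_of_mem hρ hτ' hxρ hxτ, hval τ hτ' x hxτ, hzero x hxτ, mul_zero, mul_zero]
  have hpos₂ : ∃ ρ ∈ Δ'.cones, ∃ x ∈ ρ, 0 < m₂ ρ ⬝ᵥ x := by
    obtain ⟨w, L', hwl⟩ := List.exists_cons_of_ne_nil hlne
    have hw_head : w ∈ l.head? := by rw [hwl]; simp
    have hwσ : w ∈ PointedCone.hull ℚ (S₀ : Set (κ → ℚ)) := hhead w hw_head
    have hws₀ : w ∈ Δ₀.support := by rw [hΔ₀def, Fan.support_ofCone]; exact hwσ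
    have hfw : 0 < D.f w := hhead' w hw_head hws₀
    have hws : w ∈ Δ'.support := by rw [hsupp]; exact hwσ
    obtain ⟨ρ, hρ, hwρ⟩ := Fan.mem_support.mp hws
    refine ⟨ρ, hρ, w, hwρ, ?_⟩
    rw [hval ρ hρ w hwρ]
    exact mul_pos hN' (mul_pos hMpos hfw)
  -- `G` permutes `σ` and its proper faces
  have hGσ : ∀ g ∈ G, ∀ x ∈ PointedCone.hull ℚ (S₀ : Set (κ → ℚ)), g x ∈ PointedCone.hull ℚ (S₀ : Set (κ → ℚ)) := by
    intro g hg x hx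
    have hmem : g x ∈ (PointedCone.hull ℚ (S₀ : Set (κ → ℚ))).map (g : (κ → ℚ) →ₗ[ℚ] (κ → ℚ)) :=
      PointedCone.mem_map.mpr ⟨x, hx, rfl⟩
    rwa [map_hull_eq g (hGS₀ g hg)] at hmem
  have hGF : ∀ g ∈ G, ∀ τ ∈ {τ : PointedCone ℚ (κ → ℚ) | τ.IsFaceOf (PointedCone.hull ℚ (S₀ : Set (κ → ℚ))) ∧
      τ ≠ PointedCone.hull ℚ (S₀ : Set (κ → ℚ))},
      τ.map (g : (κ → ℚ) →ₗ[ℚ] (κ → ℚ)) ∈ {τ : PointedCone ℚ (κ → ℚ) |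
        τ.IsFaceOf (PointedCone.hull ℚ (S₀ : Set (κ → ℚ))) ∧ τ ≠ PointedCone.hull ℚ (S₀ : Set (κ → ℚ))} := by
    rintro g hg τ ⟨hτ, hne⟩
    have hinj : ∀ x ∈ (⊤ : Submodule ℚ (κ → ℚ)), (g : (κ → ℚ) →ₗ[ℚ] (κ → ℚ)) x = 0 → x = 0 :=
      fun x _ hx => by simpa using hx
    have hface := isFaceOf_map_of_isFaceOf hinj hτ (fun _ _ => Submodule.mem_top)
    rw [map_hull_eq g (hGS₀ g hg)] at hface
    refine ⟨hface, fun heq => hne ?_⟩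
    have hback := congrArg (fun ρ : PointedCone ℚ (κ → ℚ) => ρ.map (g.symm : (κ → ℚ) →ₗ[ℚ] (κ → ℚ))) heq
    rw [map_map_trans, map_hull_eq g.symm (hGS₀ _ (hGsymm g hg)), LinearEquiv.self_trans_symm] at hback
    rw [← hback]
    ext x; simp
  refine ⟨fun ρ => ∑ g ∈ hGfin.toFinset,
      m₂ (ρ.map (g : (κ → ℚ) →ₗ[ℚ] (κ → ℚ))) ᵥ* LinearMap.toMatrix' (g : (κ → ℚ) →ₗ[ℚ] (κ → ℚ)),
    isStrictSupport_symm hGfin hG1 hG h₂, fun ρ hρ => symm_mem_latticeN hGfin hGN hG hint₂ hρ,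
    fun ρ hρ x hx => symm_nonneg hGfin hGσ hG hnn₂ hρ hx, ?_,
    fun h hh ρ x => symm_dotProduct_map hGfin (m := m₂) hGsymm hGtrans hh ρ x, ?_⟩
  · intro τ hτ hne ρ hρ x hxρ hxτ
    exact symm_eq_zero hGfin hGF hG (fun τ' hτ' => hvan₂ τ' hτ'.1 hτ'.2) ⟨hτ, hne⟩ hρ hxρ hxτ
  · obtain ⟨ρ, hρ, x, hx, hpos⟩ := hpos₂
    exact ⟨ρ, hρ, x, hx, symm_pos hGfin hG1 hG hnn_own hρ hx hpos⟩

end Summit.ResolutionOfSingularities.ResolutionOfSingularities.Theorems.FRationalResolution.EquivariantLadderSupport
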